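import Summits.QuantumFields.YangMills.Theorems.ColdStartUniversalityLatticeLangevinTransportMixing
import Summits.QuantumFields.YangMills.Theorems.ColdStartUniversalityLatticeLangevinPlaquetteConcentration
import Summits.QuantumFields.YangMills.Theorems.ColdStartUniversalityLatticeLangevinWilsonLoopConcentration
import Literature.MathematicalPhysics.QuantumFieldTheory.Balaban1983to89.MassGapTransferHC
import HarnessLib

/-!
# Route `ColdStartUniversality` (fixed-cut-off package): VOLUME-INDEPENDENT COLD-START EQUILIBRATION OF THE ACTION DENSITY AND OF
# SPATIALLY AVERAGED WILSON LOOPS for the SU(2) SZZ dynamics on `(ℤ/L)³` at `|β'| < 1/12`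

Helper file (seat `ym-line-csu-p1`, g28; `--supports stmt-QuantumFields-24809`).  The transport–entropy bound of
`…LatticeLangevinTransportMixing` (`|E F(U_(2+u)) − μ_(β')F| ≤ e^(−ρu)·√(s·B_L/ρ)`, `ρ = 1 − 12|β'|`, `B_L = 366|β'|L³ + 3 log(3/2) L³ + log 2`)
read on the two macroscopic observables whose carré du champ g27 bounded:
* ★★★ `wilson_coldStart_actionDensity_le_exp_explicit` — action density `S_W/#𝒫` (`Γ ≤ 64/#𝒫`, `#𝒫 = 3L³`):
  `|E S_W(U_(2+u))/#𝒫 − ∫ S_W/#𝒫 dμ_(β')| ≤ e^(−ρu) · √(64·B_L/(#𝒫·ρ))`, and since `64 B_L/#𝒫 ≤ 704 < 27²` for `|β'| < 1/12`: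
  ★★★ `wilson_coldStart_actionDensity_le_volumeFree` — `≤ 27·e^(−ρu)/√ρ` for EVERY `L`, every deterministic start, every solution;
  ★★★ `wilson_coldStart_actionDensity_mixingTime_volumeFree` — `u ≥ log(27/(ε√ρ))/ρ ⇒ |E S_W(U_(2+u))/#𝒫 − μ_(β')(S_W/#𝒫)| ≤ ε`:
  the ε-equilibration time of the action density is at most `2 + log(27/(ε√ρ))/ρ` lattice units, INDEPENDENT OF THE VOLUME
  (g27: `O(log L)` for general bounded observables);
* ★★★ `wilson_coldStart_loopAverage_le_exp_explicit` / `_le_volumeFree` / `_mixingTime_volumeFree` — the spatially averaged `R × T`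
  Wilson loop `W̄ = (L³)⁻¹ Σ_x W_(R×T)(x; i, j)` (`Γ ≤ 96(R+T)²/L³`): `|E W̄(U_(2+u)) − μ_(β')W̄| ≤ 57(R+T)·e^(−ρu)/√ρ`, ε-equilibration
  time `≤ 2 + log(57(R+T)/(ε√ρ))/ρ`, independent of `L`.
(Finite-volume, observable-wise shadow of the exponential ergodicity of the infinite-volume strong-coupling SZZ dynamics
[cite: ShenZhuZhu2022, §4 Theorem 4.2, Corollary 4.4].)  HONEST FRAMING: FIXED cut-off and fixed `|β'| < 1/12` (lattice units; "uniform" /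
"volume-free" = in the torus size `L` and in the start); the route's scaling `β'_K → ∞` leaves the window; 24809 ASIDE not restated; nothing
K-uniform; no crux, rung or summit statement is proved; the Yang–Mills mass gap is NOT proved.  THEOREMS ONLY, no definition, no sorry.
-/

set_option autoImplicit false

noncomputable section

namespace Summit.QuantumFields.YangMills.Theorems.ColdStartUniversality

open MeasureTheory ProbabilityTheory Finset Filter Set InformationTheory
open scoped BigOperators NNReal ENNReal Topology Matrix
open Literature.Probability.Process Literature.MathematicalPhysics.QuantumFieldTheory
open Literature.MathematicalPhysics.QuantumLattice (fundamentalRep fundamentalLatticeRep continuous_fundamentalRep)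

variable {L : ℕ} [NeZero L]

/-! ## §1. Arithmetic of the budget: `B_L ≤ 33 L³` -/

/-- `B_L = 366|β'|L³ + 3 log(3/2) L³ + log 2 ≤ 33·L³` for `|β'| < 1/12` and `L ≥ 1` (`log(3/2) ≤ 1/2`, `log 2 ≤ 1 ≤ L³`). [folklore] -/
theorem burnInBudget_le_volume (L : ℕ) [NeZero L] (β' : ℝ) (hβ : |β'| < 1 / 12) :
    (366 * |β'| * (L : ℝ) ^ 3 + 3 * Real.log (3 / 2) * (L : ℝ) ^ 3 + Real.log 2) ≤ 33 * (L : ℝ) ^ 3 := by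
  have hL1 : (1 : ℝ) ≤ (L : ℝ) := by exact_mod_cast Nat.one_le_iff_ne_zero.2 (NeZero.ne L)
  have hL3 : (1 : ℝ) ≤ (L : ℝ) ^ 3 := one_le_pow₀ hL1
  have h32 : Real.log (3 / 2 : ℝ) ≤ 1 / 2 := by
    have := Real.log_le_sub_one_of_pos (by norm_num : (0 : ℝ) < 3 / 2); linarith
  have h2 : Real.log (2 : ℝ) ≤ 1 := by
    have := Real.log_le_sub_one_of_pos (by norm_num : (0 : ℝ) < 2); linarith
  have hβ0 : 0 ≤ |β'| := abs_nonneg _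
  have hL30 : (0 : ℝ) ≤ (L : ℝ) ^ 3 := by positivity
  nlinarith [mul_le_mul_of_nonneg_right hβ.le hL30, mul_le_mul_of_nonneg_right h32 hL30]

/-! ## §2. The action density -/

/-- ★★★ **Cold-start equilibration of the action density, explicit.**  SU(2) SZZ dynamics on `(ℤ/L)³`, `|β'| < 1/12`: for every
deterministic start, every solution on any probability space and every `u ≥ 0`,
`|E S_W(U_(2+u))/#𝒫 − ∫ S_W/#𝒫 dμ_(β')| ≤ e^(−(1−12|β'|)u) · √(64·(366|β'|L³ + 3 log(3/2) L³ + log 2)/(#𝒫·(1 − 12|β'|)))`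
(`Γ(S_W/#𝒫) ≤ 64/#𝒫`, `wilson_plaquette_carre_le`; transport–entropy bound `wilson_coldStart_smooth_le_exp_explicit`).
[cite: ShenZhuZhu2022, §4 Theorem 4.2, Corollary 4.4] -/
theorem wilson_coldStart_actionDensity_le_exp_explicit (L : ℕ) [NeZero L] (β' : ℝ) (hβ : |β'| < 1 / 12)
    (z : (GaugeConfig 3 L (Matrix.specialUnitaryGroup (Fin 2) ℂ)))
    {Ω : Type} [MeasurableSpace Ω] {P : Measure Ω} [IsProbabilityMeasure P]
    {W : ℝ≥0 → Ω → (Edge 3 L × NoiseIdx 2 → ℝ)} (hW : IsFlatBrownian W P)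
    {U : ℝ≥0 → Ω → (GaugeConfig 3 L (Matrix.specialUnitaryGroup (Fin 2) ℂ))} (hU0 : ∀ ω, U 0 ω = z)
    (hU : (latticeLangevinDynamics (fundamentalLatticeRep 2) β').IsSolution (fundamentalRep (Fin 2)) hW.natFiltration P W U)
    (u : ℝ≥0) :
    |(∫ ω, wilsonAction (fundamentalRep (Fin 2)) (U ((2 : ℝ≥0) + u) ω) / (Fintype.card (Plaquette 3 L) : ℝ) ∂P) -
        ∫ V, wilsonAction (fundamentalRep (Fin 2)) V / (Fintype.card (Plaquette 3 L) : ℝ) ∂(wilsonMeasure (d := 3) (L := L) (fundamentalRep (Fin 2)) β')| ≤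
      Real.exp (-(1 - 12 * |β'|) * u) * Real.sqrt (64 * (366 * |β'| * (L : ℝ) ^ 3 + 3 * Real.log (3 / 2) * (L : ℝ) ^ 3 + Real.log 2) / ((Fintype.card (Plaquette 3 L) : ℝ) * (1 - 12 * |β'|))) := by
  classical
  haveI := secondCountableTopology_su2
  haveI := borelSpace_config L
  set μ : Measure (GaugeConfig 3 L (Matrix.specialUnitaryGroup (Fin 2) ℂ)) := (wilsonMeasure (d := 3) (L := L) (fundamentalRep (Fin 2)) β') with hμ
  haveI : IsProbabilityMeasure μ :=
    isProbabilityMeasure_wilsonMeasure (d := 3) (L := L) (fundamentalRep (Fin 2)) (continuous_fundamentalRep (Fin 2)) β'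
  have hρ : 0 < 1 - 12 * |β'| := by linarith
  set nP : ℝ := (Fintype.card (Plaquette 3 L) : ℝ) with hnP
  have hnPpos : 0 < nP := card_plaquette_three_pos L
  set b : ℝ := nP⁻¹ with hb
  set co : (GaugeConfig 3 L (Matrix.specialUnitaryGroup (Fin 2) ℂ)) → (Edge 3 L × Fin 2 × Fin 2 × Bool → ℝ) := (fun (V : GaugeConfig 3 L (Matrix.specialUnitaryGroup (Fin 2) ℂ)) (q : Edge 3 L × Fin 2 × Fin 2 × Bool) => (fun z : ℂ => if q.2.2.2 then z.im else z.re) ((fundamentalRep (Fin 2) (V q.1) : Matrix (Fin 2) (Fin 2) ℂ) q.2.1 q.2.2.1)) with hco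
  set fp : (Edge 3 L × Fin 2 × Fin 2 × Bool → ℝ) → ℝ := (fun y : (Edge 3 L × Fin 2 × Fin 2 × Bool → ℝ) => b * ∑ p : Plaquette 3 L, (rootedLoop (fun (ee : Edge 3 L) (i j : Fin 2) => ((y (ee, i, j, false) : ℝ) : ℂ) + ((y (ee, i, j, true) : ℝ) : ℂ) * Complex.I) (p.1, p.2.1.1) p.2.1.2 false).trace.re) with hfp
  have hfpC : ContDiff ℝ 3 fp := contDiff_psiHat (d := 3) (L := L) (N := 2) (n := 3) b
  have hval : ∀ V, fp (co V) = 2 - wilsonAction (fundamentalRep (Fin 2)) V / nP := by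
    intro V
    have h : fp (co V) = 2 * b * nP - b * wilsonAction (fundamentalRep (Fin 2)) V := psiHat_coords_eq_wilsonAction b V
    rw [h, div_eq_mul_inv, hb]
    have : 2 * nP⁻¹ * nP = 2 := by rw [mul_assoc, inv_mul_cancel₀ hnPpos.ne', mul_one]
    rw [this]; ring
  have hs : 0 < 64 * b ^ 2 * nP := by positivity
  -- the transport–entropy bound for `fp`
  have hmain : |(∫ ω, fp (co (U ((2 : ℝ≥0) + u) ω)) ∂P) - ∫ V, fp (co V) ∂μ| ≤
      Real.exp (-(1 - 12 * |β'|) * u) * Real.sqrt ((64 * b ^ 2 * nP) * (366 * |β'| * (L : ℝ) ^ 3 + 3 * Real.log (3 / 2) * (L : ℝ) ^ 3 + Real.log 2) / (1 - 12 * |β'|)) :=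
    wilson_coldStart_smooth_le_exp_explicit L β' hβ fp hfpC hs hW z hU0 hU u (wilson_plaquette_carre_le L β' b)
  -- translate values
  have hmU : ∀ t : ℝ≥0, Measurable (U t) := fun t => (hU.adapted t).mono (hW.natFiltration.le t) le_rfl
  have hSc : Continuous fun V : (GaugeConfig 3 L (Matrix.specialUnitaryGroup (Fin 2) ℂ)) => wilsonAction (fundamentalRep (Fin 2)) V / nP := by
    have hfun : (fun V : (GaugeConfig 3 L (Matrix.specialUnitaryGroup (Fin 2) ℂ)) => wilsonAction (fundamentalRep (Fin 2)) V / nP) = fun V => 2 - fp (co V) := funext fun V => by rw [hval]; ring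
    rw [hfun]
    exact continuous_const.sub (hfpC.continuous.comp (continuous_coords (L := L)))
  obtain ⟨M, hM⟩ : ∃ M, ∀ V : (GaugeConfig 3 L (Matrix.specialUnitaryGroup (Fin 2) ℂ)), ‖wilsonAction (fundamentalRep (Fin 2)) V / nP‖ ≤ M := by
    obtain ⟨M, hM⟩ := isCompact_univ.exists_bound_of_continuousOn hSc.continuousOn
    exact ⟨M, fun V => hM V (Set.mem_univ V)⟩
  have hintP : Integrable (fun ω => wilsonAction (fundamentalRep (Fin 2)) (U ((2 : ℝ≥0) + u) ω) / nP) P :=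
    Integrable.of_bound ((hSc.measurable.comp (hmU _)).aestronglyMeasurable) M (ae_of_all _ fun ω => hM _)
  have hintμ : Integrable (fun V => wilsonAction (fundamentalRep (Fin 2)) V / nP) μ := integrable_of_continuous_of_compactSpace hSc _
  have hEP : ∫ ω, fp (co (U ((2 : ℝ≥0) + u) ω)) ∂P = 2 - ∫ ω, wilsonAction (fundamentalRep (Fin 2)) (U ((2 : ℝ≥0) + u) ω) / nP ∂P := by
    have hfun : (fun ω => fp (co (U ((2 : ℝ≥0) + u) ω))) = fun ω => (2 : ℝ) - wilsonAction (fundamentalRep (Fin 2)) (U ((2 : ℝ≥0) + u) ω) / nP := funext fun ω => hval _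
    rw [hfun, integral_sub (integrable_const _) hintP, integral_const]
    simp
  have hEμ : ∫ V, fp (co V) ∂μ = 2 - ∫ V, wilsonAction (fundamentalRep (Fin 2)) V / nP ∂μ := by
    have hfun : (fun V => fp (co V)) = fun V => (2 : ℝ) - wilsonAction (fundamentalRep (Fin 2)) V / nP := funext hval
    rw [hfun, integral_sub (integrable_const _) hintμ, integral_const]
    simp
  rw [hEP, hEμ] at hmain
  have e1 : |(2 - ∫ ω, wilsonAction (fundamentalRep (Fin 2)) (U ((2 : ℝ≥0) + u) ω) / nP ∂P) - (2 - ∫ V, wilsonAction (fundamentalRep (Fin 2)) V / nP ∂μ)| =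
      |(∫ ω, wilsonAction (fundamentalRep (Fin 2)) (U ((2 : ℝ≥0) + u) ω) / nP ∂P) - ∫ V, wilsonAction (fundamentalRep (Fin 2)) V / nP ∂μ| := by
    rw [← abs_neg]; congr 1; ring
  rw [e1] at hmain
  have e2 : (64 * b ^ 2 * nP) * (366 * |β'| * (L : ℝ) ^ 3 + 3 * Real.log (3 / 2) * (L : ℝ) ^ 3 + Real.log 2) / (1 - 12 * |β'|) =
      64 * (366 * |β'| * (L : ℝ) ^ 3 + 3 * Real.log (3 / 2) * (L : ℝ) ^ 3 + Real.log 2) / (nP * (1 - 12 * |β'|)) := by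
    rw [hb]
    field_simp
  rw [e2] at hmain
  exact hmain

/-- ★★★ **VOLUME-FREE cold-start equilibration of the action density.**  SU(2) SZZ dynamics on `(ℤ/L)³`, `|β'| < 1/12`, `ρ = 1 − 12|β'|`: for
EVERY torus size `L`, every deterministic start, every solution and every `u ≥ 0`,
`|E S_W(U_(2+u))/#𝒫 − ∫ S_W/#𝒫 dμ_(β')| ≤ 27 · e^(−ρu) / √ρ` (`64 B_L/#𝒫 ≤ 704 < 27²`). [cite: ShenZhuZhu2022, §4 Theorem 4.2, Corollary 4.4] -/
theorem wilson_coldStart_actionDensity_le_volumeFree (L : ℕ) [NeZero L] (β' : ℝ) (hβ : |β'| < 1 / 12)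
    (z : (GaugeConfig 3 L (Matrix.specialUnitaryGroup (Fin 2) ℂ)))
    {Ω : Type} [MeasurableSpace Ω] {P : Measure Ω} [IsProbabilityMeasure P]
    {W : ℝ≥0 → Ω → (Edge 3 L × NoiseIdx 2 → ℝ)} (hW : IsFlatBrownian W P)
    {U : ℝ≥0 → Ω → (GaugeConfig 3 L (Matrix.specialUnitaryGroup (Fin 2) ℂ))} (hU0 : ∀ ω, U 0 ω = z)
    (hU : (latticeLangevinDynamics (fundamentalLatticeRep 2) β').IsSolution (fundamentalRep (Fin 2)) hW.natFiltration P W U)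
    (u : ℝ≥0) :
    |(∫ ω, wilsonAction (fundamentalRep (Fin 2)) (U ((2 : ℝ≥0) + u) ω) / (Fintype.card (Plaquette 3 L) : ℝ) ∂P) -
        ∫ V, wilsonAction (fundamentalRep (Fin 2)) V / (Fintype.card (Plaquette 3 L) : ℝ) ∂(wilsonMeasure (d := 3) (L := L) (fundamentalRep (Fin 2)) β')| ≤
      27 * Real.exp (-(1 - 12 * |β'|) * u) / Real.sqrt (1 - 12 * |β'|) := by
  have hρ : 0 < 1 - 12 * |β'| := by linarith
  have h := wilson_coldStart_actionDensity_le_exp_explicit L β' hβ z hW hU0 hU u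
  refine h.trans ?_
  have hP : (Fintype.card (Plaquette 3 L) : ℝ) = 3 * (L : ℝ) ^ 3 := by
    rw [card_plaquette_three]; push_cast; ring
  have hL30 : (0 : ℝ) < (L : ℝ) ^ 3 := by
    have hL : 0 < L := Nat.pos_of_ne_zero (NeZero.ne L)
    positivity
  have hB := burnInBudget_le_volume L β' hβ
  -- `64 B_L/(#𝒫 ρ) ≤ 729/ρ`
  have hq : 64 * (366 * |β'| * (L : ℝ) ^ 3 + 3 * Real.log (3 / 2) * (L : ℝ) ^ 3 + Real.log 2) / ((Fintype.card (Plaquette 3 L) : ℝ) * (1 - 12 * |β'|)) ≤ (27 / Real.sqrt (1 - 12 * |β'|)) ^ 2 := by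
    rw [div_pow, Real.sq_sqrt hρ.le, hP, div_le_div_iff₀ (by positivity) hρ]
    nlinarith [hB, hρ, hL30]
  have hsq : Real.sqrt (64 * (366 * |β'| * (L : ℝ) ^ 3 + 3 * Real.log (3 / 2) * (L : ℝ) ^ 3 + Real.log 2) / ((Fintype.card (Plaquette 3 L) : ℝ) * (1 - 12 * |β'|))) ≤ 27 / Real.sqrt (1 - 12 * |β'|) :=
    (Real.sqrt_le_sqrt hq).trans (le_of_eq (Real.sqrt_sq (by positivity)))
  calc Real.exp (-(1 - 12 * |β'|) * u) * Real.sqrt (64 * (366 * |β'| * (L : ℝ) ^ 3 + 3 * Real.log (3 / 2) * (L : ℝ) ^ 3 + Real.log 2) / ((Fintype.card (Plaquette 3 L) : ℝ) * (1 - 12 * |β'|)))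
      ≤ Real.exp (-(1 - 12 * |β'|) * u) * (27 / Real.sqrt (1 - 12 * |β'|)) := mul_le_mul_of_nonneg_left hsq (Real.exp_pos _).le
    _ = 27 * Real.exp (-(1 - 12 * |β'|) * u) / Real.sqrt (1 - 12 * |β'|) := by ring

/-- ★★★ **VOLUME-INDEPENDENT equilibration time of the action density.**  SU(2) SZZ dynamics on `(ℤ/L)³`, `|β'| < 1/12`, `ρ = 1 − 12|β'|`:
for every `ε > 0` and every `u ≥ log(27/(ε√ρ))/ρ`, every `L`, every deterministic start and every solution,
`|E S_W(U_(2+u))/#𝒫 − ∫ S_W/#𝒫 dμ_(β')| ≤ ε` — the action density equilibrates to accuracy `ε` within `2 + log(27/(ε√ρ))/ρ` lattice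
time units, a bound that does NOT depend on the volume. [cite: ShenZhuZhu2022, §4 Theorem 4.2, Corollary 4.4] -/
theorem wilson_coldStart_actionDensity_mixingTime_volumeFree (L : ℕ) [NeZero L] (β' : ℝ) (hβ : |β'| < 1 / 12)
    (z : (GaugeConfig 3 L (Matrix.specialUnitaryGroup (Fin 2) ℂ)))
    {Ω : Type} [MeasurableSpace Ω] {P : Measure Ω} [IsProbabilityMeasure P]
    {W : ℝ≥0 → Ω → (Edge 3 L × NoiseIdx 2 → ℝ)} (hW : IsFlatBrownian W P)
    {U : ℝ≥0 → Ω → (GaugeConfig 3 L (Matrix.specialUnitaryGroup (Fin 2) ℂ))} (hU0 : ∀ ω, U 0 ω = z)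
    (hU : (latticeLangevinDynamics (fundamentalLatticeRep 2) β').IsSolution (fundamentalRep (Fin 2)) hW.natFiltration P W U)
    {ε : ℝ} (hε : 0 < ε) (u : ℝ≥0) (hu : Real.log (27 / (ε * Real.sqrt (1 - 12 * |β'|))) / (1 - 12 * |β'|) ≤ (u : ℝ)) :
    |(∫ ω, wilsonAction (fundamentalRep (Fin 2)) (U ((2 : ℝ≥0) + u) ω) / (Fintype.card (Plaquette 3 L) : ℝ) ∂P) -
        ∫ V, wilsonAction (fundamentalRep (Fin 2)) V / (Fintype.card (Plaquette 3 L) : ℝ) ∂(wilsonMeasure (d := 3) (L := L) (fundamentalRep (Fin 2)) β')| ≤ ε := by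
  have hρ : 0 < 1 - 12 * |β'| := by linarith
  have hsρ : 0 < Real.sqrt (1 - 12 * |β'|) := Real.sqrt_pos.2 hρ
  have h := wilson_coldStart_actionDensity_le_volumeFree L β' hβ z hW hU0 hU u
  refine h.trans ?_
  have hu' : Real.log (27 / (ε * Real.sqrt (1 - 12 * |β'|))) ≤ (1 - 12 * |β'|) * u := by
    rw [div_le_iff₀ hρ] at hu
    linarith
  have hexp : Real.exp (-(1 - 12 * |β'|) * u) ≤ (ε * Real.sqrt (1 - 12 * |β'|)) / 27 := by
    have h1 : Real.exp (-(1 - 12 * |β'|) * u) ≤ Real.exp (-Real.log (27 / (ε * Real.sqrt (1 - 12 * |β'|)))) := Real.exp_le_exp.2 (by linarith)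
    rw [Real.exp_neg, Real.exp_log (by positivity), inv_div] at h1
    exact h1
  calc 27 * Real.exp (-(1 - 12 * |β'|) * u) / Real.sqrt (1 - 12 * |β'|)
      ≤ 27 * ((ε * Real.sqrt (1 - 12 * |β'|)) / 27) / Real.sqrt (1 - 12 * |β'|) :=
        div_le_div_of_nonneg_right (mul_le_mul_of_nonneg_left hexp (by norm_num)) hsρ.le
    _ = ε := by field_simp

/-! ## §3. Spatially averaged Wilson loops -/

/-- ★★★ **Cold-start equilibration of the spatially averaged `R × T` Wilson loop, explicit.**  SU(2) SZZ dynamics on `(ℤ/L)³`, `|β'| < 1/12`,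
`R + T > 0`: for every deterministic start, every solution and every `u ≥ 0`, with `W̄ = (#sites)⁻¹ Σ_x W_(R×T)(x; i, j)`,
`|E W̄(U_(2+u)) − ∫ W̄ dμ_(β')| ≤ e^(−(1−12|β'|)u) · √(96(R+T)²·(366|β'|L³ + 3 log(3/2) L³ + log 2)/(#sites·(1 − 12|β'|)))`
(`Γ(W̄) ≤ 96(R+T)²/#sites`, `wilson_loopAverage_carre_le`). [cite: ShenZhuZhu2022, §4 Theorem 4.2, Corollary 4.4] -/
theorem wilson_coldStart_loopAverage_le_exp_explicit (L : ℕ) [NeZero L] (β' : ℝ) (hβ : |β'| < 1 / 12) (i j : Fin 3) (R T : ℕ)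
    (hRT : 0 < R + T) (z : (GaugeConfig 3 L (Matrix.specialUnitaryGroup (Fin 2) ℂ)))
    {Ω : Type} [MeasurableSpace Ω] {P : Measure Ω} [IsProbabilityMeasure P]
    {W : ℝ≥0 → Ω → (Edge 3 L × NoiseIdx 2 → ℝ)} (hW : IsFlatBrownian W P)
    {U : ℝ≥0 → Ω → (GaugeConfig 3 L (Matrix.specialUnitaryGroup (Fin 2) ℂ))} (hU0 : ∀ ω, U 0 ω = z)
    (hU : (latticeLangevinDynamics (fundamentalLatticeRep 2) β').IsSolution (fundamentalRep (Fin 2)) hW.natFiltration P W U)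
    (u : ℝ≥0) :
    |(∫ ω, (((Fintype.card (Site 3 L) : ℝ))⁻¹ * ∑ x : Site 3 L, wilsonLoop (fundamentalRep (Fin 2)) x i j R T (U ((2 : ℝ≥0) + u) ω)) ∂P) -
        ∫ V, (((Fintype.card (Site 3 L) : ℝ))⁻¹ * ∑ x : Site 3 L, wilsonLoop (fundamentalRep (Fin 2)) x i j R T V) ∂(wilsonMeasure (d := 3) (L := L) (fundamentalRep (Fin 2)) β')| ≤
      Real.exp (-(1 - 12 * |β'|) * u) * Real.sqrt (96 * ((R : ℝ) + T) ^ 2 * (366 * |β'| * (L : ℝ) ^ 3 + 3 * Real.log (3 / 2) * (L : ℝ) ^ 3 + Real.log 2) / ((Fintype.card (Site 3 L) : ℝ) * (1 - 12 * |β'|))) := by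
  classical
  haveI := secondCountableTopology_su2
  haveI := borelSpace_config L
  set μ : Measure (GaugeConfig 3 L (Matrix.specialUnitaryGroup (Fin 2) ℂ)) := (wilsonMeasure (d := 3) (L := L) (fundamentalRep (Fin 2)) β') with hμ
  haveI : IsProbabilityMeasure μ :=
    isProbabilityMeasure_wilsonMeasure (d := 3) (L := L) (fundamentalRep (Fin 2)) (continuous_fundamentalRep (Fin 2)) β'
  have hρ : 0 < 1 - 12 * |β'| := by linarith
  have hS : (0 : ℝ) < (Fintype.card (Site 3 L) : ℝ) := card_site_three_pos L
  have hRT' : (0 : ℝ) < (R : ℝ) + T := by exact_mod_cast hRT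
  set co : (GaugeConfig 3 L (Matrix.specialUnitaryGroup (Fin 2) ℂ)) → (Edge 3 L × Fin 2 × Fin 2 × Bool → ℝ) := (fun (V : GaugeConfig 3 L (Matrix.specialUnitaryGroup (Fin 2) ℂ)) (q : Edge 3 L × Fin 2 × Fin 2 × Bool) => (fun z : ℂ => if q.2.2.2 then z.im else z.re) ((fundamentalRep (Fin 2) (V q.1) : Matrix (Fin 2) (Fin 2) ℂ) q.2.1 q.2.2.1)) with hco
  set fp : (Edge 3 L × Fin 2 × Fin 2 × Bool → ℝ) → ℝ := (fun y : (Edge 3 L × Fin 2 × Fin 2 × Bool → ℝ) => (2 * (Fintype.card (Site 3 L) : ℝ))⁻¹ * ∑ x : Site 3 L, ((((((List.range R).map (fun m : ℕ => ((Pi.single i ((m : ℕ) : ZMod L) : Site 3 L), i, false)) ++ (List.range T).map (fun m : ℕ => ((Pi.single i ((R : ℕ) : ZMod L) : Site 3 L) + (Pi.single j ((m : ℕ) : ZMod L) : Site 3 L), j, false)) ++ ((List.range R).map (fun m : ℕ => ((Pi.single j ((T : ℕ) : ZMod L) : Site 3 L) + (Pi.single i ((m : ℕ) : ZMod L) : Site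 3 L), i, true))).reverse ++ ((List.range T).map (fun m : ℕ => ((Pi.single j ((m : ℕ) : ZMod L) : Site 3 L), j, true))).reverse).map (fun q : Site 3 L × Fin 3 × Bool => ((x + q.1, q.2.1), q.2.2))).map (fun a : Edge 3 L × Bool => if a.2 then ((fun (ee : Edge 3 L) => Matrix.of fun (i j : Fin 2) => ((y (ee, i, j, false) : ℝ) : ℂ) + ((y (ee, i, j, true) : ℝ) : ℂ) * Complex.I) a.1)ᴴ else (fun (ee : Edge 3 L) => Matrix.of fun (i j : Fin 2) => ((y (ee, i, j, false) : ℝ) : ℂ) + ((y (ee, i, j, true) : ℝ) : ℂ) * Complex.I) a.1)).prod)).trace.re) with hfp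
  have hfpC : ContDiff ℝ 3 fp := contDiff_loopAverage _ _
  have hval : ∀ V : (GaugeConfig 3 L (Matrix.specialUnitaryGroup (Fin 2) ℂ)), fp (co V) = (((Fintype.card (Site 3 L) : ℝ))⁻¹ * ∑ x : Site 3 L, wilsonLoop (fundamentalRep (Fin 2)) x i j R T V) := fun V => loopAverage_coords_eq V i j R T
  have hlen : (((((List.range R).map (fun m : ℕ => ((Pi.single i ((m : ℕ) : ZMod L) : Site 3 L), i, false)) ++ (List.range T).map (fun m : ℕ => ((Pi.single i ((R : ℕ) : ZMod L) : Site 3 L) + (Pi.single j ((m : ℕ) : ZMod L) : Site 3 L), j, false)) ++ ((List.range R).map (fun m : ℕ => ((Pi.single j ((T : ℕ) : ZMod L) : Site 3 L) + (Pi.single i ((m : ℕ) : ZMod L) : Site 3 L), i, true))).reverse ++ ((List.range T).map (fun m : ℕ => ((Pi.single j ((m : ℕ) : ZMod L) : Site 3 L), j, true))).reverse)).length : ℕ) : ℝ) = 2 * ((R : ℝ) + T) := by rw [rectShape_length]; push_cast; ring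
  have hs : 0 < 32 * ((2 * (Fintype.card (Site 3 L) : ℝ))⁻¹) ^ 2 * (((((List.range R).map (fun m : ℕ => ((Pi.single i ((m : ℕ) : ZMod L) : Site 3 L), i, false)) ++ (List.range T).map (fun m : ℕ => ((Pi.single i ((R : ℕ) : ZMod L) : Site 3 L) + (Pi.single j ((m : ℕ) : ZMod L) : Site 3 L), j, false)) ++ ((List.range R).map (fun m : ℕ => ((Pi.single j ((T : ℕ) : ZMod L) : Site 3 L) + (Pi.single i ((m : ℕ) : ZMod L) : Site 3 L), i, true))).reverse ++ ((List.range T).map (fun m : ℕ => ((Pi.single j ((m : ℕ) : ZMod L) : Site 3 L), j, true))).reverse)).length : ℕ) : ℝ) ^ 2 * Fintype.card (Edge 3 L) := by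
    have : 0 < ((2 * (Fintype.card (Site 3 L) : ℝ))⁻¹) ^ 2 := by positivity
    rw [hlen, card_edge_eq_three_mul_card_site]
    positivity
  have hmain : |(∫ ω, fp (co (U ((2 : ℝ≥0) + u) ω)) ∂P) - ∫ V, fp (co V) ∂μ| ≤
      Real.exp (-(1 - 12 * |β'|) * u) * Real.sqrt ((32 * ((2 * (Fintype.card (Site 3 L) : ℝ))⁻¹) ^ 2 * (((((List.range R).map (fun m : ℕ => ((Pi.single i ((m : ℕ) : ZMod L) : Site 3 L), i, false)) ++ (List.range T).map (fun m : ℕ => ((Pi.single i ((R : ℕ) : ZMod L) : Site 3 L) + (Pi.single j ((m : ℕ) : ZMod L) : Site 3 L), j, false)) ++ ((List.range R).map (fun m : ℕ => ((Pi.single j ((T : ℕ) : ZMod L) : Site 3 L) + (Pi.single i ((m : ℕ) : ZMod L) : Site 3 L), i, true))).reverse ++ ((List.range T).map (fun m : ℕ => ((Pi.single j ((m : ℕ) : ZMod L) : Site 3 L), j, true))).reverse)).length : ℕ) : ℝ) ^ 2 * Fintype.card (Edge 3 L)) * (366 * |β'| * (L : ℝ) ^ 3 + 3 * Real.log (3 /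 2) * (L : ℝ) ^ 3 + Real.log 2) / (1 - 12 * |β'|)) :=
    wilson_coldStart_smooth_le_exp_explicit L β' hβ fp hfpC hs hW z hU0 hU u (wilson_loopAverage_carre_le L β' _ _)
  have hEP : ∫ ω, fp (co (U ((2 : ℝ≥0) + u) ω)) ∂P = ∫ ω, (((Fintype.card (Site 3 L) : ℝ))⁻¹ * ∑ x : Site 3 L, wilsonLoop (fundamentalRep (Fin 2)) x i j R T (U ((2 : ℝ≥0) + u) ω)) ∂P :=
    integral_congr_ae (ae_of_all _ fun ω => by beta_reduce; rw [hval])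
  have hEμ : ∫ V, fp (co V) ∂μ = ∫ V, (((Fintype.card (Site 3 L) : ℝ))⁻¹ * ∑ x : Site 3 L, wilsonLoop (fundamentalRep (Fin 2)) x i j R T V) ∂μ :=
    integral_congr_ae (ae_of_all _ fun V => by beta_reduce; rw [hval])
  have e2 : (32 * ((2 * (Fintype.card (Site 3 L) : ℝ))⁻¹) ^ 2 * (((((List.range R).map (fun m : ℕ => ((Pi.single i ((m : ℕ) : ZMod L) : Site 3 L), i, false)) ++ (List.range T).map (fun m : ℕ => ((Pi.single i ((R : ℕ) : ZMod L) : Site 3 L) + (Pi.single j ((m : ℕ) : ZMod L) : Site 3 L), j, false)) ++ ((List.range R).map (fun m : ℕ => ((Pi.single j ((T : ℕ) : ZMod L) : Site 3 L) + (Pi.single i ((m : ℕ) : ZMod L) : Site 3 L), i, true))).reverse ++ ((List.range T).map (fun m : ℕ => ((Pi.single j ((m : ℕ) : ZMod L) : Site 3 L), j, true))).reverse)).length : ℕ) : ℝ) ^ 2 * Fintype.card (Edge 3 L)) * (366 * |β'| * (L : ℝ) ^ 3 + 3 * Real.log (3 / 2) * (L : ℝ) ^ 3 + Real.log 2) / (1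 - 12 * |β'|) =
      96 * ((R : ℝ) + T) ^ 2 * (366 * |β'| * (L : ℝ) ^ 3 + 3 * Real.log (3 / 2) * (L : ℝ) ^ 3 + Real.log 2) / ((Fintype.card (Site 3 L) : ℝ) * (1 - 12 * |β'|)) := by
    rw [hlen, card_edge_eq_three_mul_card_site]
    field_simp
    ring
  rw [hEP, hEμ, e2] at hmain
  exact hmain

/-- ★★★ **VOLUME-FREE cold-start equilibration of spatially averaged Wilson loops.**  SU(2) SZZ dynamics on `(ℤ/L)³`, `|β'| < 1/12`,
`ρ = 1 − 12|β'|`, `R + T > 0`: for EVERY `L`, every deterministic start, every solution and every `u ≥ 0`,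
`|E W̄(U_(2+u)) − ∫ W̄ dμ_(β')| ≤ 57(R+T) · e^(−ρu)/√ρ` (`96·33 = 3168 < 57²`). [cite: ShenZhuZhu2022, §4 Theorem 4.2, Corollary 4.4] -/
theorem wilson_coldStart_loopAverage_le_volumeFree (L : ℕ) [NeZero L] (β' : ℝ) (hβ : |β'| < 1 / 12) (i j : Fin 3) (R T : ℕ)
    (hRT : 0 < R + T) (z : (GaugeConfig 3 L (Matrix.specialUnitaryGroup (Fin 2) ℂ)))
    {Ω : Type} [MeasurableSpace Ω] {P : Measure Ω} [IsProbabilityMeasure P]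
    {W : ℝ≥0 → Ω → (Edge 3 L × NoiseIdx 2 → ℝ)} (hW : IsFlatBrownian W P)
    {U : ℝ≥0 → Ω → (GaugeConfig 3 L (Matrix.specialUnitaryGroup (Fin 2) ℂ))} (hU0 : ∀ ω, U 0 ω = z)
    (hU : (latticeLangevinDynamics (fundamentalLatticeRep 2) β').IsSolution (fundamentalRep (Fin 2)) hW.natFiltration P W U)
    (u : ℝ≥0) :
    |(∫ ω, (((Fintype.card (Site 3 L) : ℝ))⁻¹ * ∑ x : Site 3 L, wilsonLoop (fundamentalRep (Fin 2)) x i j R T (U ((2 : ℝ≥0) + u) ω)) ∂P) -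
        ∫ V, (((Fintype.card (Site 3 L) : ℝ))⁻¹ * ∑ x : Site 3 L, wilsonLoop (fundamentalRep (Fin 2)) x i j R T V) ∂(wilsonMeasure (d := 3) (L := L) (fundamentalRep (Fin 2)) β')| ≤
      57 * ((R : ℝ) + T) * Real.exp (-(1 - 12 * |β'|) * u) / Real.sqrt (1 - 12 * |β'|) := by
  have hρ : 0 < 1 - 12 * |β'| := by linarith
  have hRT' : (0 : ℝ) < (R : ℝ) + T := by exact_mod_cast hRT
  have h := wilson_coldStart_loopAverage_le_exp_explicit L β' hβ i j R T hRT z hW hU0 hU u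
  refine h.trans ?_
  have hSite : (Fintype.card (Site 3 L) : ℝ) = (L : ℝ) ^ 3 := by
    rw [card_site_three]; push_cast; ring
  have hL30 : (0 : ℝ) < (L : ℝ) ^ 3 := by
    have hL : 0 < L := Nat.pos_of_ne_zero (NeZero.ne L)
    positivity
  have hB := burnInBudget_le_volume L β' hβ
  have hq : 96 * ((R : ℝ) + T) ^ 2 * (366 * |β'| * (L : ℝ) ^ 3 + 3 * Real.log (3 / 2) * (L : ℝ) ^ 3 + Real.log 2) / ((Fintype.card (Site 3 L) : ℝ) * (1 - 12 * |β'|)) ≤ (57 * ((R : ℝ) + T) / Real.sqrt (1 - 12 * |β'|)) ^ 2 := by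
    rw [div_pow, Real.sq_sqrt hρ.le, hSite, div_le_div_iff₀ (by positivity) hρ]
    have hRT2 : 0 < ((R : ℝ) + T) ^ 2 := by positivity
    nlinarith [mul_le_mul_of_nonneg_left hB (le_of_lt (mul_pos hRT2 hρ)), mul_pos (mul_pos hRT2 hρ) hL30]
  have hsq : Real.sqrt (96 * ((R : ℝ) + T) ^ 2 * (366 * |β'| * (L : ℝ) ^ 3 + 3 * Real.log (3 / 2) * (L : ℝ) ^ 3 + Real.log 2) / ((Fintype.card (Site 3 L) : ℝ) * (1 - 12 * |β'|))) ≤ 57 * ((R : ℝ) + T) / Real.sqrt (1 - 12 * |β'|) :=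
    (Real.sqrt_le_sqrt hq).trans (le_of_eq (Real.sqrt_sq (by positivity)))
  calc Real.exp (-(1 - 12 * |β'|) * u) * Real.sqrt (96 * ((R : ℝ) + T) ^ 2 * (366 * |β'| * (L : ℝ) ^ 3 + 3 * Real.log (3 / 2) * (L : ℝ) ^ 3 + Real.log 2) / ((Fintype.card (Site 3 L) : ℝ) * (1 - 12 * |β'|)))
      ≤ Real.exp (-(1 - 12 * |β'|) * u) * (57 * ((R : ℝ) + T) / Real.sqrt (1 - 12 * |β'|)) := mul_le_mul_of_nonneg_left hsq (Real.exp_pos _).le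
    _ = 57 * ((R : ℝ) + T) * Real.exp (-(1 - 12 * |β'|) * u) / Real.sqrt (1 - 12 * |β'|) := by ring

/-- ★★★ **VOLUME-INDEPENDENT equilibration time of spatially averaged Wilson loops.**  SU(2) SZZ dynamics on `(ℤ/L)³`, `|β'| < 1/12`,
`ρ = 1 − 12|β'|`, `R + T > 0`: for every `ε > 0` and every `u ≥ log(57(R+T)/(ε√ρ))/ρ`, every `L`, every deterministic start and every
solution, `|E W̄(U_(2+u)) − ∫ W̄ dμ_(β')| ≤ ε` (`W̄ = (#sites)⁻¹ Σ_x W_(R×T)(x; i, j)`): accuracy `ε` within `2 + log(57(R+T)/(ε√ρ))/ρ`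
lattice time units, independently of the volume. [cite: ShenZhuZhu2022, §4 Theorem 4.2, Corollary 4.4] -/
theorem wilson_coldStart_loopAverage_mixingTime_volumeFree (L : ℕ) [NeZero L] (β' : ℝ) (hβ : |β'| < 1 / 12) (i j : Fin 3) (R T : ℕ)
    (hRT : 0 < R + T) (z : (GaugeConfig 3 L (Matrix.specialUnitaryGroup (Fin 2) ℂ)))
    {Ω : Type} [MeasurableSpace Ω] {P : Measure Ω} [IsProbabilityMeasure P]
    {W : ℝ≥0 → Ω → (Edge 3 L × NoiseIdx 2 → ℝ)} (hW : IsFlatBrownian W P)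
    {U : ℝ≥0 → Ω → (GaugeConfig 3 L (Matrix.specialUnitaryGroup (Fin 2) ℂ))} (hU0 : ∀ ω, U 0 ω = z)
    (hU : (latticeLangevinDynamics (fundamentalLatticeRep 2) β').IsSolution (fundamentalRep (Fin 2)) hW.natFiltration P W U)
    {ε : ℝ} (hε : 0 < ε) (u : ℝ≥0) (hu : Real.log (57 * ((R : ℝ) + T) / (ε * Real.sqrt (1 - 12 * |β'|))) / (1 - 12 * |β'|) ≤ (u : ℝ)) :
    |(∫ ω, (((Fintype.card (Site 3 L) : ℝ))⁻¹ * ∑ x : Site 3 L, wilsonLoop (fundamentalRep (Fin 2)) x i j R T (U ((2 : ℝ≥0) + u) ω)) ∂P) -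
        ∫ V, (((Fintype.card (Site 3 L) : ℝ))⁻¹ * ∑ x : Site 3 L, wilsonLoop (fundamentalRep (Fin 2)) x i j R T V) ∂(wilsonMeasure (d := 3) (L := L) (fundamentalRep (Fin 2)) β')| ≤ ε := by
  have hρ : 0 < 1 - 12 * |β'| := by linarith
  have hsρ : 0 < Real.sqrt (1 - 12 * |β'|) := Real.sqrt_pos.2 hρ
  have hRT' : (0 : ℝ) < (R : ℝ) + T := by exact_mod_cast hRT
  have h := wilson_coldStart_loopAverage_le_volumeFree L β' hβ i j R T hRT z hW hU0 hU u
  refine h.trans ?_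
  have hu' : Real.log (57 * ((R : ℝ) + T) / (ε * Real.sqrt (1 - 12 * |β'|))) ≤ (1 - 12 * |β'|) * u := by
    rw [div_le_iff₀ hρ] at hu
    linarith
  have hexp : Real.exp (-(1 - 12 * |β'|) * u) ≤ (ε * Real.sqrt (1 - 12 * |β'|)) / (57 * ((R : ℝ) + T)) := by
    have h1 : Real.exp (-(1 - 12 * |β'|) * u) ≤ Real.exp (-Real.log (57 * ((R : ℝ) + T) / (ε * Real.sqrt (1 - 12 * |β'|)))) := Real.exp_le_exp.2 (by linarith)
    rw [Real.exp_neg, Real.exp_log (by positivity), inv_div] at h1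
    exact h1
  calc 57 * ((R : ℝ) + T) * Real.exp (-(1 - 12 * |β'|) * u) / Real.sqrt (1 - 12 * |β'|)
      ≤ 57 * ((R : ℝ) + T) * ((ε * Real.sqrt (1 - 12 * |β'|)) / (57 * ((R : ℝ) + T))) / Real.sqrt (1 - 12 * |β'|) :=
        div_le_div_of_nonneg_right (mul_le_mul_of_nonneg_left hexp (by positivity)) hsρ.le
    _ = ε := by field_simp

end Summit.QuantumFields.YangMills.Theorems.ColdStartUniversality
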